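/-
Copyright: derived here (Resolution Observatory cell `pub-rosobs`, carver gen 57). AI-written Lean; AI review is weaker than expert
review.  Engine 1's LEMMA K (THEOREM-LT-eng1-g38 §1; CARVER-NOTES-eng1-g38 T57, by name) for the cell's POLYNOMIAL weighted-centre
model `W(f)`, as a corollary of the tree's linear-rigidity lemma: the pin-form differential `Κ : T ↦ (∂_T P_h)_h` is injective when
pins persist.  Instrument — NOT a resolution theorem and NOT a statement about the invariant of [AbramovichTemkinWlodarczyk2024].
-/
import Literature.AlgebraicGeometry.Resolution.WeightedCentreLinearRigidity
import Mathlib.LinearAlgebra.Basis.VectorSpace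
import HarnessLib

/-!
# LEMMA K: the pin-form differential `Κ : T ↦ (∂_T P_h)_h` is injective under persistent pins (T57)

Uniform value line: INSTRUMENT — kernel-checked linear algebra / characteristic-`p` calculus for engine 1's LEMMA K
(THEOREM-LT-eng1-g38 §1) in the cell's polynomial weighted-centre model `W(f)`; NOT a resolution theorem, NOT a statement about the
Abramovich–Temkin–Włodarczyk invariant, NOT summit progress; AI-written Lean, AI review is weaker than expert review.

## Dictionary (THEOREM-LT-eng1-g38 §1 ↔ this file)

`K` a field of characteristic `p`; the variables `X_σ` (the engine's class `C = w⁻¹{w₀}`, possibly together with other slots — a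
direction `r` supported on `C` changes nothing outside `C`); a family of PIN FORMS `P : ι → K[X_σ]` (`P_h`, `h` running over the heavy
monomials), `P_h` homogeneous of degree `d_h < p` (the engine's "totalDegree-in-`C` of `P_h` `< p`"; pin forms are forms in the
`C`-variables, all of weight `w₀`, so weighted-homogeneous = homogeneous).
* `kappa P : (σ → K) →ₗ[K] (ι → K[X_σ])`, `T ↦ (Σ_f T_f ∂_f P_h)_h` — the engine's `Κ`.
* `(P)_C` in the form the proof uses (hypothesis `hpin`): for every class-linear change `A = lineSubst w₀ T` (`A e_{w₀} = T`, the
  tree's `WeightedCentreDirectionalDerivative.lineSubst`; invertible when `T_{w₀} ≠ 0`, `lineSubst_bijective`) the slot `w₀` stays pinned in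
  the new coordinates, i.e. `X_{w₀}` occurs in SOME transformed pin form `P_h ∘ A` (the pin forms of `g ∘ A` are the `P_h ∘ A`: `A` is linear
  inside the class and the identity on the heavy and light variables, so it preserves heavy parts and `C`-degrees).
* **LEMMA K** (`kappa_eq_zero_imp_eq_zero`, `injective_kappa_of_pinned`, `ker_kappa_eq_bot_of_pinned`): `(P)_C ∧ (∀ h, d_h < p) ⇒ Κ`
  injective.  Proof = the engine's six lines, of which the tree already holds five: a kernel vector `T ≠ 0` has a coordinate `T_{w₀} ≠ 0`;
  `∂_{w₀} (P_h ∘ A) = (∂_T P_h) ∘ A = 0` and `deg < p` give `X_{w₀} ∉ vars (P_h ∘ A)` for EVERY `h`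
  (`LinearRigidity.notMem_vars_lineSubst_of_isHomogeneous'`, the char-`p` derivative criterion of `WeightedCentreLayerEquation` §6 inside);
  this contradicts `hpin`.  The single-form case is g56's `QuadraticRigidity.injective_dirDerivLin_of_pinned` (T45).
* `exists_leftInverse_kappa` — the `K`-linear left inverse `Λ ∘ Κ = id` used by LEMMA LL Statement B (Mathlib).

References: [Hironaka1970AdditiveGroups] (additive forms and differential operators: the derivative criterion in characteristic `p`);
context [AbramovichTemkinWlodarczyk2024] §5.2 (coordinate changes preserving a weighted centre).  Statements ours, elementary.
-/

namespace Literature.AlgebraicGeometry.Resolution.WeightedBlowup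

namespace PinFamily

open MvPolynomial

variable {K : Type*} [Field K] {σ : Type*} [Fintype σ] {ι : Type*}

/-- The pin-form differential `Κ : T ↦ (∂_T P_h)_h = (Σ_f T_f • ∂_f P_h)_h`, `K`-linear in the constant direction `T`
(engine 1's `Κ` of LEMMA K). [cite: Hironaka1970AdditiveGroups, additive forms and differential operators] -/
noncomputable def kappa (P : ι → MvPolynomial σ K) : (σ → K) →ₗ[K] (ι → MvPolynomial σ K) where
  toFun r h := ∑ k, r k • pderiv k (P h)
  map_add' r s := by
    funext h
    simp only [Pi.add_apply, add_smul, Finset.sum_add_distrib]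
  map_smul' c r := by
    funext h
    simp only [Pi.smul_apply, smul_eq_mul, RingHom.id_apply, Finset.smul_sum, mul_smul]

/-- Unfolding `Κ`. [cite: Hironaka1970AdditiveGroups, additive forms and differential operators] -/
theorem kappa_apply (P : ι → MvPolynomial σ K) (r : σ → K) (h : ι) :
    kappa P r h = ∑ k, r k • pderiv k (P h) := rfl

variable [DecidableEq σ]

/-- **LEMMA K, kernel form.**  Pin forms `P_h` homogeneous of degrees `d_h < p = char K`; if every slot `w₀` stays pinned after every
class-linear change `lineSubst w₀ T` with `T_{w₀} ≠ 0` (`hpin`, the model's `(P)_C`), then `∂_T P_h = 0` for all `h` forces `T = 0`.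
[cite: Hironaka1970AdditiveGroups, additive forms and differential operators] -/
theorem kappa_eq_zero_imp_eq_zero (p : ℕ) [CharP K p] {P : ι → MvPolynomial σ K} {d : ι → ℕ}
    (hP : ∀ h, (P h).IsHomogeneous (d h)) (hd : ∀ h, d h < p)
    (hpin : ∀ (w₀ : σ) (T : σ → K), T w₀ ≠ 0 → ∃ h, w₀ ∈ (lineSubst w₀ T (P h)).vars)
    {T : σ → K} (hT : ∀ h, ∑ k, T k • pderiv k (P h) = 0) : T = 0 := by
  by_contra hne
  obtain ⟨w₀, hw₀⟩ := Function.ne_iff.mp hne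
  obtain ⟨h, hmem⟩ := hpin w₀ T hw₀
  exact LinearRigidity.notMem_vars_lineSubst_of_isHomogeneous' p w₀ T (hP h) (hd h) (hT h) hmem

/-- **LEMMA K (T57 by name): `Κ` is injective under persistent pins.**
[cite: Hironaka1970AdditiveGroups, additive forms and differential operators] -/
theorem injective_kappa_of_pinned (p : ℕ) [CharP K p] {P : ι → MvPolynomial σ K} {d : ι → ℕ}
    (hP : ∀ h, (P h).IsHomogeneous (d h)) (hd : ∀ h, d h < p)
    (hpin : ∀ (w₀ : σ) (T : σ → K), T w₀ ≠ 0 → ∃ h, w₀ ∈ (lineSubst w₀ T (P h)).vars) :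
    Function.Injective (kappa P) := by
  rw [← LinearMap.ker_eq_bot, LinearMap.ker_eq_bot']
  intro T hT
  exact kappa_eq_zero_imp_eq_zero p hP hd hpin fun h => by
    have := congrFun hT h
    simpa [kappa_apply] using this

/-- The same as `ker Κ = ⊥`. [cite: Hironaka1970AdditiveGroups, additive forms and differential operators] -/
theorem ker_kappa_eq_bot_of_pinned (p : ℕ) [CharP K p] {P : ι → MvPolynomial σ K} {d : ι → ℕ}
    (hP : ∀ h, (P h).IsHomogeneous (d h)) (hd : ∀ h, d h < p)
    (hpin : ∀ (w₀ : σ) (T : σ → K), T w₀ ≠ 0 → ∃ h, w₀ ∈ (lineSubst w₀ T (P h)).vars) :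
    LinearMap.ker (kappa P) = ⊥ :=
  LinearMap.ker_eq_bot.mpr (injective_kappa_of_pinned p hP hd hpin)

/-- **The left inverse of `Κ`** (input of LEMMA LL Statement B): under persistent pins there is a `K`-linear `Λ` with `Λ ∘ Κ = id`.
[cite: Hironaka1970AdditiveGroups, additive forms and differential operators] -/
theorem exists_leftInverse_kappa (p : ℕ) [CharP K p] {P : ι → MvPolynomial σ K} {d : ι → ℕ}
    (hP : ∀ h, (P h).IsHomogeneous (d h)) (hd : ∀ h, d h < p)
    (hpin : ∀ (w₀ : σ) (T : σ → K), T w₀ ≠ 0 → ∃ h, w₀ ∈ (lineSubst w₀ T (P h)).vars) :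
    ∃ Λ : (ι → MvPolynomial σ K) →ₗ[K] (σ → K), Λ.comp (kappa P) = LinearMap.id :=
  LinearMap.exists_leftInverse_of_injective _ (ker_kappa_eq_bot_of_pinned p hP hd hpin)

/-- The contrapositive the engine states ("a kernel vector `T ≠ 0` unpins a slot"): if `Κ T = 0` with `T_{w₀} ≠ 0` then `X_{w₀}` occurs in
NO transformed pin form `P_h ∘ lineSubst w₀ T`. [cite: Hironaka1970AdditiveGroups, additive forms and differential operators] -/
theorem notMem_vars_of_kappa_eq_zero (p : ℕ) [CharP K p] {P : ι → MvPolynomial σ K} {d : ι → ℕ}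
    (hP : ∀ h, (P h).IsHomogeneous (d h)) (hd : ∀ h, d h < p) {T : σ → K} (hT : kappa P T = 0) {w₀ : σ}
    (h : ι) : w₀ ∉ (lineSubst w₀ T (P h)).vars :=
  LinearRigidity.notMem_vars_lineSubst_of_isHomogeneous' p w₀ T (hP h) (hd h) (by
    have := congrFun hT h
    simpa [kappa_apply] using this)

end PinFamily

end Literature.AlgebraicGeometry.Resolution.WeightedBlowup
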